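import Summits.ResolutionOfSingularities.ResolutionOfSingularities.Theorems.FrobeniusClosingPatchingRelPerfectDepthPhaseCContactLegality
import Summits.ResolutionOfSingularities.ResolutionOfSingularities.Theorems.FrobeniusClosingPatchingRelPerfectDepthPhaseCContactSingBridge
import Summits.ResolutionOfSingularities.ResolutionOfSingularities.Theorems.FrobeniusClosingPatchingRelPerfectDepthPhaseCX3DefsPieces
import Literature.AlgebraicGeometry.Resolution.EmbeddedResolutionExcellentSurfacesBoundary
import Literature.AlgebraicGeometry.Resolution.HasSNCStrictNormalCrossings
import Literature.AlgebraicGeometry.Resolution.NormalCrossingsLocal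
import Literature.AlgebraicGeometry.Resolution.ComponentGluing
import Literature.AlgebraicGeometry.Resolution.ExcellentBlowup
import Literature.AlgebraicGeometry.Resolution.ResolutionGlue
import Literature.AlgebraicGeometry.Resolution.BlowupRestrictOpen
import Literature.AlgebraicGeometry.Resolution.AlterationsProofs
import Literature.AlgebraicGeometry.Resolution.BlowupDisjointCentreWeights
import HarnessLib

/-!
# Crux `PatchingRelPerfect` (stmt-ResolutionOfSingularities-16161), chain W5.2 — F7(β) (β-AX) X3 C-I (M2b) in the (β′) architecture: THE CONTACT
# CURE ON A PIECE, §1 — F-60 IN THE FOURFOLD, REALISED AS A BLOW-UP SEQUENCE OF THE PATCH WITH CENTRES OVER THE PIECE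

[OURS · L1 W5.2 · RECORD R13-3 (res-L1-w52-lead-1 g6: the cure side being unhanded, lead-1 takes §1); targets of record `X3LemmaM.ContactCure₃Pw₃` /
`ContactCureReduction₃Pw₃` (…X3DefsPieces rev 3).]  Replaces the role of NO printed item; NOT a statement of the manuscript under review (AI-written;
AI review weaker than expert review; counted 0).  Def-free.  CONDITIONAL on the named fact F-60 `CossartJannsenSaito2020EmbeddedSequenceBoundary`
(hypothesis `hF60`; honest fact list ⟨F-60⟩).

§1 `exists_realisedCure_of_F60` — STATE-FREE REALISATION: on a regular excellent Noetherian `X`, letters `E` with simple normal crossings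
(boundary `B := ⋃ Supp E`), a closed contact set `Sfc`, a piece `P` and an open patch `W` on which LEG holds («singular points of `Sfc_red` and points
of `Sfc ∩ B` inside `W` lie in `P`»); IF the reduced contact surface `(Sfc ∩ W)_red` has dimension `≤ 2` and no irreducible component inside `B`,
THEN F-60 applied in the FOURFOLD `W` (ambient `Z := W`, `X := (Sfc ∩ W)_red`, boundary `B ∩ W` — a strict normal crossings divisor by
`HasSNC.isStrictNormalCrossingsDivisor_biUnion_support`) and realised by res-D-repro-1΄s `ContactRealisation.centresOver_singOrBoundary` gives a blow-up
sequence `s` of `W` with regular centres OVER `P` (`image_compl_regularLocus_subscheme` + `comap_vanishingIdeal_of_isOpenImmersion` turn the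
quotient-stalk «Sing» of the realisation into LEG΄s image form), regular top (`Z₁` regular), together with F-60΄s end data (`IsBPermissibleSequenceB`,
the identification `e : s.top ≅ Z₁`, regular strict transform, sncd boundary, total transform, transversality) for the END extraction (§2, next file).
The two hypotheses `hdim`/`hcomp` are discharged from `HasContactFormOnPw₃` (K21 + NF0, resp. NF1 + stalkwise principal entries) in §1b.

## References
* V. Cossart, U. Jannsen, S. Saito, arXiv:0905.2191v2 (2020), Thm. 1.4, Def. 6.8, Thm. 6.9 (a). [CossartJannsenSaito2020]
* U. Görtz, T. Wedhorn, *Algebraic Geometry I* (2nd ed. 2020), Prop. 13.91. [GortzWedhorn2020]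
-/

-- `Summit.<Summit>.<Sub>.Theorems` with `Sub = Summit` (single-conjunct summit, D-0017)
set_option linter.dupNamespace false

noncomputable section

namespace Summit.ResolutionOfSingularities.ResolutionOfSingularities.Theorems.X3LemmaM

open CategoryTheory AlgebraicGeometry TopologicalSpace IsLocalRing
open Literature.AlgebraicGeometry.Resolution
open Scheme.IdealSheafData

universe u

/-- Pulling the boundary back to an open: `W.ι ⁻¹' ⋃_{D ∈ E} Supp D = ⋃_{D ∈ E.map (·.comap W.ι)} Supp D`. [folklore] -/
theorem preimage_biUnion_support_eq {X : Scheme.{u}} (E : List X.IdealSheafData) (W : X.Opens) :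
    W.ι.base ⁻¹' (⋃ D ∈ E, (D.support : Set X)) = ⋃ D ∈ E.map (·.comap W.ι), (D.support : Set (W : Scheme.{u})) := by
  ext w
  simp only [Set.mem_preimage, Set.mem_iUnion, List.mem_map, exists_prop]
  constructor
  · rintro ⟨D, hD, hw⟩
    exact ⟨D.comap W.ι, ⟨D, hD, rfl⟩, (mem_support_comap_iff W.ι D w).mpr hw⟩
  · rintro ⟨_, ⟨D, hD, rfl⟩, hw⟩
    exact ⟨D, hD, (mem_support_comap_iff W.ι D w).mp hw⟩

/-- [OURS · L1 W5.2 · X3 C-I (M2b), (β′)] **F-60 IN THE FOURFOLD, REALISED** (state-free form; conditional on F-60).  See the module doc.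
[cite: CossartJannsenSaito2020, Thm. 1.4, Thm. 6.9 (a)] [cite: GortzWedhorn2020, Prop. 13.91] -/
theorem exists_realisedCure_of_F60 (hF60 : CossartJannsenSaito2020EmbeddedSequenceBoundary.{u})
    {X : Scheme.{u}} [IsNoetherian X] (hX : Scheme.IsRegular X) (hXe : Scheme.IsExcellent X)
    (E : List X.IdealSheafData) (hE : HasSNC E) (Sfc : Set X) (hSfc : IsClosed Sfc) (P : Set X) (W : X.Opens)
    (hLEG : ∀ y ∈ (W : Set X),
      (y ∈ (vanishingIdeal (⟨Sfc, hSfc⟩ : Closeds X)).subschemeι.base ''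
          (Scheme.regularLocus (vanishingIdeal (⟨Sfc, hSfc⟩ : Closeds X)).subscheme)ᶜ ∨
        (y ∈ Sfc ∧ y ∈ ⋃ D ∈ E, (D.support : Set X))) → y ∈ P)
    (hdim : topologicalKrullDim
      (vanishingIdeal ((⟨Sfc, hSfc⟩ : Closeds X).preimage W.ι.continuous)).subscheme ≤ 2)
    (hcomp : ∀ T ∈ irreducibleComponents
        ((vanishingIdeal ((⟨Sfc, hSfc⟩ : Closeds X).preimage W.ι.continuous)).subscheme : Type u),
      ¬ T ⊆ (vanishingIdeal ((⟨Sfc, hSfc⟩ : Closeds X).preimage W.ι.continuous)).subschemeι.base ⁻¹'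
        (W.ι.base ⁻¹' ⋃ D ∈ E, (D.support : Set X))) :
    ∃ s : CentreSeq (W : Scheme.{u}), s.AllRegular ∧ s.CentresOver (W.ι.base ⁻¹' P) ∧ Scheme.IsRegular s.top ∧
      ∃ (Z₁ : Scheme.{u}) (π : Z₁ ⟶ (W : Scheme.{u})) (X₁ B₁ : Set Z₁) (e : s.top ≅ Z₁),
        IsBPermissibleSequenceB (W.ι.base ⁻¹' Sfc) (W.ι.base ⁻¹' ⋃ D ∈ E, (D.support : Set X)) π X₁ B₁ ∧
        e.hom ≫ π = s.comp ∧ Scheme.IsRegular Z₁ ∧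
        Scheme.IsRegular (vanishingIdeal (⟨closure X₁, isClosed_closure⟩ : Closeds Z₁)).subscheme ∧
        IsStrictNormalCrossingsDivisor Z₁ B₁ ∧
        π.base ⁻¹' (W.ι.base ⁻¹' Sfc ∪ W.ι.base ⁻¹' ⋃ D ∈ E, (D.support : Set X)) = X₁ ∪ B₁ ∧ IsTransversalWith Z₁ X₁ B₁ := by
  -- the patch
  haveI : CompactSpace (W : Scheme.{u}) := isCompact_iff_compactSpace.mp (TopologicalSpace.NoetherianSpace.isCompact (W : Set X))
  haveI : IsNoetherian (W : Scheme.{u}) := ⟨⟩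
  have hWreg : Scheme.IsRegular (W : Scheme.{u}) := Scheme.IsRegular.of_isOpenImmersion W.ι hX
  have hWexc : Scheme.IsExcellent (W : Scheme.{u}) := Scheme.IsExcellent.of_isOpenImmersion W.ι hXe
  -- the reduced contact surface on the patch
  set 𝒳W : Closeds (W : Scheme.{u}) := (⟨Sfc, hSfc⟩ : Closeds X).preimage W.ι.continuous with h𝒳W
  have h𝒳Wcoe : (𝒳W : Set (W : Scheme.{u})) = W.ι.base ⁻¹' Sfc := rfl
  set J : (W : Scheme.{u}).IdealSheafData := vanishingIdeal 𝒳W with hJ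
  haveI : IsReduced J.subscheme := ComponentGluing.isReduced_subscheme_vanishingIdeal 𝒳W
  have hrange : Set.range J.subschemeι.base = W.ι.base ⁻¹' Sfc := by
    rw [Scheme.IdealSheafData.range_subschemeι, hJ, Scheme.IdealSheafData.coe_support_vanishingIdeal]; rfl
  -- the boundary on the patch is a strict normal crossings divisor
  set B : Set (W : Scheme.{u}) := W.ι.base ⁻¹' ⋃ D ∈ E, (D.support : Set X) with hB
  have hsncd : IsStrictNormalCrossingsDivisor (W : Scheme.{u}) B := by
    have h1 := (hE.comap_of_isOpenImmersion (f := W.ι)).isStrictNormalCrossingsDivisor_biUnion_support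
    rw [hB, preimage_biUnion_support_eq]
    exact h1
  -- F-60
  obtain ⟨Z₁, π, X₁, B₁, hseq, hZ₁, -, -, -, hX₁reg, hB₁, htot, htr⟩ :=
    hF60 J.subscheme (W : Scheme.{u}) J.subschemeι B hWreg hWexc hdim hsncd hcomp
  rw [hrange] at hseq htot
  -- realisation with legality
  obtain ⟨-, -, -, t, e, he, htreg, -, hoverT⟩ := ContactRealisation.centresOver_singOrBoundary hseq
  have hcl : closure (W.ι.base ⁻¹' Sfc) = W.ι.base ⁻¹' Sfc := (hSfc.preimage W.ι.continuous).closure_eq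
  refine ⟨t, htreg, ?_, Scheme.IsRegular.of_iso e.inv hZ₁, Z₁, π, X₁, B₁, e, hseq, he, hZ₁, hX₁reg, hB₁, htot, htr⟩
  -- every centre lies over `P`: the realisation΄s «singular or boundary» set is inside `W.ι ⁻¹' P` by LEG
  refine CentreSeq.CentresOver.mono t (fun z hz => ?_) hoverT
  have hzW : W.ι.base z ∈ (W : Set X) := by rw [← Scheme.Opens.range_ι W]; exact ⟨z, rfl⟩
  show W.ι.base z ∈ P
  refine hLEG _ hzW ?_
  rcases hz with ⟨hzX, hsing⟩ | ⟨hzX, hzB⟩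
  · -- singular point of the reduced contact surface: transport the quotient stalk along the open immersion `W.ι`
    left
    rw [hcl] at hzX
    rw [ContactRealisation.image_compl_regularLocus_subscheme]
    refine ⟨by rw [Scheme.IdealSheafData.coe_support_vanishingIdeal]; exact hzX, fun hreg => hsing ?_⟩
    have hcomap : (vanishingIdeal (⟨Sfc, hSfc⟩ : Closeds X)).comap W.ι =
        vanishingIdeal (⟨closure (W.ι.base ⁻¹' Sfc), isClosed_closure⟩ : Closeds (W : Scheme.{u})) := by
      rw [comap_vanishingIdeal_of_isOpenImmersion]
      congr 1
      exact Closeds.ext hcl.symm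
    obtain ⟨φ⟩ := ContactRealisation.nonempty_ringEquiv_quot_of_isIso_stalkMap W.ι (vanishingIdeal (⟨Sfc, hSfc⟩ : Closeds X)) z
    rw [hcomap] at φ
    exact IsRegularLocalRing.of_ringEquiv φ
  · right
    rw [hcl] at hzX
    exact ⟨hzX, hzB⟩

end Summit.ResolutionOfSingularities.ResolutionOfSingularities.Theorems.X3LemmaM

end
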